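import Summits.ResolutionOfSingularities.ResolutionOfSingularities.Theorems.FrobeniusLadderFInjectiveMacaulayficationFedderCriterion
import Summits.ResolutionOfSingularities.ResolutionOfSingularities.Theorems.FrobeniusLadderFInjectiveMacaulayficationCIJacobian
import Summits.ResolutionOfSingularities.ResolutionOfSingularities.Theorems.FrobeniusLadderFInjectiveMacaulayficationCICodimTwoCM
import Summits.ResolutionOfSingularities.ResolutionOfSingularities.Theorems.FrobeniusLadderFInjectiveMacaulayficationWFixAtNonClosedDimTwo
import Summits.ResolutionOfSingularities.ResolutionOfSingularities.Theorems.FrobeniusLadderFInjectiveMacaulayficationLocalBlowupBadFibreFromCharts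
import Summits.ResolutionOfSingularities.ResolutionOfSingularities.Theorems.FrobeniusLadderFInjectiveMacaulayficationPencilFedder
import Summits.ResolutionOfSingularities.ResolutionOfSingularities.Theorems.FrobeniusLadderFRationalResolutionFRationalCM
import HarnessLib

/-!
# BED Ω ROW ENGINE, NOT-FULL direction IN THE TRUE CHART SHAPE: a codimension-2 complete intersection `V(g₁, g₂)` with `V(g₁)` REGULAR at the point is NOT FULL wherever
# `g₂^{p−1} ∈ 𝔪^{[p]} + (g₁)` — Fedder's necessity for the hypersurface `ḡ₂ = 0` in the regular local ring `k[Y]_𝔪/(g₁)`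
# (crux `FInjectiveMacaulayfication` stmt-ResolutionOfSingularities-15315, chain w45a; ON CALL item of SEAT TABLE v35.0, completing ✓p689316 / ✓p692285 / ✓p692717; seat res-L1-w45a-stub-1 g14)

[OURS · L1 W4.5a] Support file (`--supports stmt-ResolutionOfSingularities-15315 --as helper`); theorems only; unconditional; ANY field of characteristic `p`. Nothing of the crux is proved;
no census row is asserted. AI-written (AI review is weaker than expert review).

WHY. On a regular class model `X̃` the chart of the pencil blow-up `S′ = Bl_{(M₁, M₂h)}X̃` is, in ambient coordinates, the codimension-2 complete intersection `V(g_c, M₁·W − M₂h)` with `V(g_c) = X̃ ∩ U_c`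
REGULAR (idea-1 Q17-r0 §Ω-L2, tri-2 (†)). ✓p689316 `pencilChart_not_full_at` treated the model case `X̃ = 𝔸ⁿ`; this file is the version a kernel row for Ω₁ actually consumes: the base is a regular HYPERSURFACE `V(g₁)`,
and the deep condition `M₁^j B^{p−1−j} ∈ 𝔪^{[p]}` (all `j`) is allowed to hold MODULO `g₁`.
* §1 `not_fullCl_of_mem_sup_atPrime` — the abstract core (Fedder's necessity for `R₁/(g₂)`, `R₁ = (S₁)_{Q₁}` regular local; all rings variables).
* §2 ★★ `ci2_not_fullCl_stalk_of_mem` — `g₁` prime, `g₁ ∤ g₂`; `y` any point of `V(g₁, g₂)` with `𝔭_y ∩ k[Y] = (a₁, …, a_{m′})`, `∂_i g₁ ∉ 𝔭_y` for some `i` (so `(k[Y]/(g₁))_{𝔭}` is a regular local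
  ring, ✓ `CIJacobian.isRegularLocalRing_stalk_of_det_not_mem`), and `g₂^{p−1} ∈ (a₁^p, …, a_{m′}^p) + (g₁)`: then `𝒪_{V(g₁,g₂), y}` is NOT `FullCl p` (✓ `Fedder.fedder_hypersurface_clause_iff`
  in `(k[Y]/(g₁))_𝔭`, reached along `k[Y]/(g₁,g₂) ≅ (k[Y]/(g₁))/(ḡ₂)` and ✓ `exists_quotLocalizationEquiv`, ✓ `LocalBlowupBadFibreFromCharts.fullCl_localization_of_ringEquiv`).
* §3 ★ `pencilChartCI_not_full_of_deep` — the pencil case `g₂ = M·L − B` (ANY `L`, e.g. `L = Y_w − c` at the fibre point with `W`-coordinate `c`, or the pole chart): the deep condition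
  `M^j·B^{p−1−j} ∈ (aᵢ^p) + (G)` for all `j ≤ p − 1` gives `g₂^{p−1} ∈ (aᵢ^p) + (G)` by ✓p689316 `PencilFedder.pencil_pow_mem`, so the whole fibre line over a deep point is NOT FULL —
  tri-2's (†), «⇒» direction, in kernel currency.
[cite: Fedder1983, Prop. 1.7 and Thm. 1.12]
-/

set_option linter.dupNamespace false

noncomputable section

open AlgebraicGeometry IsLocalRing RingTheory.Sequence Literature.AlgebraicGeometry.Resolution Literature.RingTheory.TightClosure MvPolynomial
open scoped Pointwise

namespace Summit.ResolutionOfSingularities.ResolutionOfSingularities.Theorems.FInjectiveMacaulayfication.PencilFedderNotFullCI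

open Summit.ResolutionOfSingularities.ResolutionOfSingularities.Theorems.FInjectiveMacaulayfication
open SliceableCentre TauFloorOneCIChartCM

variable (k : Type) [Field k]

/-! ## §1 The abstract core -/

/-- **The abstract core** (all rings are variables, so that no instance path of a concrete localisation enters unification): `S₁` a domain, `R₁ = (S₁)_{Q₁}` a regular local ring of
characteristic `p`, `mk₁ : A → S₁` a ring map with `mk₁ g₁ = 0`, `mk₁ aⱼ, mk₁ g₂ ∈ Q₁`, `mk₁ g₂ ≠ 0`, and `g₂^{p−1} ∈ (aⱼ^p) + (g₁)` in `A`; then NO ring `T ≅ R₁/(g₂)` is `FullCl p` (Fedder's necessity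
✓ `Fedder.fedder_hypersurface_clause_iff` for the hypersurface `g₂ = 0` in `R₁`). [cite: Fedder1983, Thm. 1.12] -/
theorem not_fullCl_of_mem_sup_atPrime (p : ℕ) [Fact p.Prime] {A S₁ R₁ T : Type} [CommRing A] [CommRing S₁] [IsDomain S₁] [CommRing R₁] [Algebra S₁ R₁]
    (Q₁ : Ideal S₁) [Q₁.IsPrime] [IsLocalization.AtPrime R₁ Q₁] [IsRegularLocalRing R₁] [CharP R₁ p] [CommRing T]
    (mk₁ : A →+* S₁) {m' : ℕ} (a : Fin m' → A) (ha : ∀ j, mk₁ (a j) ∈ Q₁) (g₁ g₂ : A) (hg₁ : mk₁ g₁ = 0) (hg₂Q : mk₁ g₂ ∈ Q₁) (hg₂0 : mk₁ g₂ ≠ 0)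
    (hmem : g₂ ^ (p - 1) ∈ Ideal.span (Set.range fun j : Fin m' => a j ^ p) ⊔ Ideal.span {g₁})
    (e : T ≃+* R₁ ⧸ Ideal.span {algebraMap S₁ R₁ (mk₁ g₂)}) : ¬ FullCl p T := by
  have hmax : ∀ x : S₁, x ∈ Q₁ → algebraMap S₁ R₁ x ∈ maximalIdeal R₁ := fun x hx =>
    (IsLocalization.AtPrime.to_map_mem_maximal_iff R₁ Q₁ x).mpr hx
  have hinj : Function.Injective (algebraMap S₁ R₁) := IsLocalization.injective R₁ Q₁.primeCompl_le_nonZeroDivisors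
  have hf0 : algebraMap S₁ R₁ (mk₁ g₂) ≠ 0 := fun h => hg₂0 (hinj (by rw [h, map_zero]))
  intro hT
  have hcl := (WFixAtNonClosedDimTwo.fullCl_of_ringEquiv p e hT).2
  apply (Fedder.fedder_hypersurface_clause_iff p (hmax _ hg₂Q) hf0).1 hcl
  -- `g₂^{p−1} ∈ 𝔪^{[p]}` downstairs
  obtain ⟨u, hu, v, hv, huv⟩ := Submodule.mem_sup.1 hmem
  have hv0 : algebraMap S₁ R₁ (mk₁ v) = 0 := by
    obtain ⟨c, rfl⟩ := Ideal.mem_span_singleton'.1 hv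
    rw [map_mul, map_mul, hg₁, map_zero, mul_zero]
  rw [← map_pow, ← map_pow, ← huv, map_add, map_add, hv0, add_zero]
  have hle : Ideal.span (Set.range fun j : Fin m' => a j ^ p) ≤ (frobeniusPower p (maximalIdeal R₁)).comap ((algebraMap S₁ R₁).comp mk₁) := by
    rw [Ideal.span_le]
    rintro _ ⟨j, rfl⟩
    rw [SetLike.mem_coe, Ideal.mem_comap, map_pow]
    exact pow_mem_frobeniusPower (hmax _ (ha j))
  exact hle hu

/-! ## §2 ★★ NOT FULL over a regular hypersurface base -/

set_option maxHeartbeats 800000 in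
set_option synthInstance.maxHeartbeats 100000 in
-- several ring-structure transports through a double quotient and two localisations
/-- ★★ **A CODIMENSION-2 COMPLETE INTERSECTION OVER A REGULAR HYPERSURFACE BASE IS NOT FULL AT A DEEP POINT**: `g₁` prime, `g₁ ∤ g₂`; `y` ANY point of `V(g₁, g₂) ⊂ 𝔸^m` (closed or not) whose prime
contracts to `(a₁, …, a_{m′}) ⊂ k[Y]`; `∂_i g₁ ∉ 𝔭_y` (the base `V(g₁)` is regular at `y`); `g₂^{p−1} ∈ (a₁^p, …, a_{m′}^p) + (g₁)`. Then `𝒪_{V(g₁,g₂), y}` is NOT `FullCl p`. The regular local ring used is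
`(k[Y]/(g₁))_{𝔪_y}` (a localisation of a quotient, ✓ `CIJacobian.isRegularLocalRing_stalk_of_det_not_mem`), reached from `𝒪_y` through `k[Y]/(g₁, g₂) ≅ (k[Y]/(g₁))/(ḡ₂)` and
✓ `exists_quotLocalizationEquiv`. [cite: Fedder1983, Prop. 1.7 and Thm. 1.12] -/
theorem ci2_not_fullCl_stalk_of_mem (p : ℕ) [Fact p.Prime] [CharP k p] {m m' : ℕ} (g₁ g₂ : MvPolynomial (Fin m) k) (hg₁ : Prime g₁) (hg₂ : ¬ g₁ ∣ g₂)
    (a : Fin m' → MvPolynomial (Fin m) k) (y : Spec (.of (MvPolynomial (Fin m) k ⧸ Ideal.span {g₁, g₂})))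
    (ha : y.asIdeal.comap (Ideal.Quotient.mk (Ideal.span {g₁, g₂})) = Ideal.span (Set.range a))
    (i : Fin m) (hjac : pderiv i g₁ ∉ y.asIdeal.comap (Ideal.Quotient.mk (Ideal.span {g₁, g₂})))
    (hmem : g₂ ^ (p - 1) ∈ Ideal.span (Set.range fun j : Fin m' => a j ^ p) ⊔ Ideal.span {g₁}) :
    ¬ FullCl p ((Spec (.of (MvPolynomial (Fin m) k ⧸ Ideal.span {g₁, g₂}))).presheaf.stalk y) := by
  classical
  -- the base `S₁ = k[Y]/(g₁)`, presented with `Set.range` for `CIJacobian`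
  obtain ⟨f₁, hf₁⟩ : ∃ f₁ : Fin 1 → MvPolynomial (Fin m) k, f₁ = fun _ => g₁ := ⟨_, rfl⟩
  have hI₁ : Ideal.span (Set.range f₁) = Ideal.span {g₁} := by rw [hf₁, Set.range_const]
  haveI hI₁p : (Ideal.span (Set.range f₁)).IsPrime := by rw [hI₁]; exact (Ideal.span_singleton_prime hg₁.ne_zero).mpr hg₁
  haveI : IsDomain (MvPolynomial (Fin m) k ⧸ Ideal.span (Set.range f₁)) := Ideal.Quotient.isDomain _
  have hsup : (Ideal.span {g₁, g₂} : Ideal (MvPolynomial (Fin m) k)) = Ideal.span (Set.range f₁) ⊔ Ideal.span {g₂} := by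
    rw [hI₁, ← Ideal.span_union, Set.singleton_union]
  have hmapg₂ : (Ideal.span {g₂} : Ideal (MvPolynomial (Fin m) k)).map (Ideal.Quotient.mk (Ideal.span (Set.range f₁))) =
      Ideal.span {Ideal.Quotient.mk (Ideal.span (Set.range f₁)) g₂} := by
    rw [Ideal.map_span, Set.image_singleton]
  -- `k[Y]/(g₁, g₂) ≅ S₁/(ḡ₂)`
  obtain ⟨e₀, he₀⟩ : ∃ e₀ : (MvPolynomial (Fin m) k ⧸ Ideal.span {g₁, g₂}) ≃+*
      (MvPolynomial (Fin m) k ⧸ Ideal.span (Set.range f₁)) ⧸ Ideal.span {Ideal.Quotient.mk (Ideal.span (Set.range f₁)) g₂},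
      ∀ x, e₀ (Ideal.Quotient.mk _ x) = Ideal.Quotient.mk _ (Ideal.Quotient.mk _ x) :=
    ⟨((Ideal.quotEquivOfEq hsup).trans (DoubleQuot.quotQuotEquivQuotSup _ _).symm).trans (Ideal.quotEquivOfEq hmapg₂), fun x => by
      simp only [RingEquiv.trans_apply, Ideal.quotEquivOfEq_mk, DoubleQuot.quotQuotEquivQuotSup_symm_quotQuotMk, DoubleQuot.quotQuotMk,
        RingHom.comp_apply]⟩
  -- the primes downstairs
  obtain ⟨Q', hQ'⟩ : ∃ Q' : Ideal ((MvPolynomial (Fin m) k ⧸ Ideal.span (Set.range f₁)) ⧸ Ideal.span {Ideal.Quotient.mk (Ideal.span (Set.range f₁)) g₂}),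
      Q' = y.asIdeal.comap e₀.symm.toRingHom := ⟨_, rfl⟩
  haveI : Q'.IsPrime := by rw [hQ']; exact Ideal.comap_isPrime _ _
  have hyQ' : y.asIdeal = Q'.comap e₀.toRingHom := by
    ext x
    simp only [hQ', Ideal.mem_comap, RingEquiv.toRingHom_eq_coe, RingHom.coe_coe, RingEquiv.symm_apply_apply]
  set Q₁ : Ideal (MvPolynomial (Fin m) k ⧸ Ideal.span (Set.range f₁)) :=
    Q'.comap (Ideal.Quotient.mk (Ideal.span {Ideal.Quotient.mk (Ideal.span (Set.range f₁)) g₂})) with hQ₁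
  haveI : Q₁.IsPrime := Ideal.comap_isPrime _ _
  have hPy : Q₁.comap (Ideal.Quotient.mk (Ideal.span (Set.range f₁))) = y.asIdeal.comap (Ideal.Quotient.mk (Ideal.span {g₁, g₂})) := by
    ext x
    simp only [hQ₁, hQ', Ideal.mem_comap, RingEquiv.toRingHom_eq_coe, RingHom.coe_coe]
    rw [← he₀, RingEquiv.symm_apply_apply]
  have hg₂Q : Ideal.Quotient.mk (Ideal.span (Set.range f₁)) g₂ ∈ Q₁ := by
    have h : g₂ ∈ Q₁.comap (Ideal.Quotient.mk (Ideal.span (Set.range f₁))) := by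
      rw [hPy, Ideal.mem_comap, Ideal.Quotient.eq_zero_iff_mem.mpr (Ideal.subset_span (Or.inr rfl) : g₂ ∈ (Ideal.span {g₁, g₂} : Ideal (MvPolynomial (Fin m) k)))]
      exact y.asIdeal.zero_mem
    exact Ideal.mem_comap.1 h
  have haQ : ∀ j, Ideal.Quotient.mk (Ideal.span (Set.range f₁)) (a j) ∈ Q₁ := fun j => by
    have h : a j ∈ Q₁.comap (Ideal.Quotient.mk (Ideal.span (Set.range f₁))) := by rw [hPy, ha]; exact Ideal.subset_span ⟨j, rfl⟩
    exact Ideal.mem_comap.1 h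
  have hg₁0 : Ideal.Quotient.mk (Ideal.span (Set.range f₁)) g₁ = 0 :=
    Ideal.Quotient.eq_zero_iff_mem.mpr (by rw [hI₁]; exact Ideal.mem_span_singleton_self _)
  have hg₂0 : Ideal.Quotient.mk (Ideal.span (Set.range f₁)) g₂ ≠ 0 := fun h => by
    rw [Ideal.Quotient.eq_zero_iff_mem, hI₁, Ideal.mem_span_singleton] at h; exact hg₂ h
  -- the regular local ring `R₁ = (k[Y]/(g₁))_{Q₁}` of characteristic `p`
  haveI : IsRegularLocalRing (Localization.AtPrime (Q₁.comap (Ideal.Quotient.mk (Ideal.span (Set.range f₁))))) :=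
    IsRegularRing.isRegularLocalRing_localization _
  haveI : IsRegularLocalRing (Localization.AtPrime Q₁) :=
    (CIJacobian.isRegularLocalRing_stalk_of_det_not_mem f₁ Q₁ (fun _ : Fin 1 => (pderiv i).restrictScalars ℤ) (by
      simp only [Matrix.det_unique, Matrix.of_apply, Derivation.coe_restrictScalars, hf₁]
      rw [hPy]; exact hjac)).1
  haveI : CharP (MvPolynomial (Fin m) k ⧸ Ideal.span (Set.range f₁)) p := FRationalResolution.charP_quotient_of_ne_top p _ hI₁p.ne_top
  haveI : CharP (Localization.AtPrime Q₁) p :=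
    charP_of_injective_algebraMap (IsLocalization.injective (Localization.AtPrime Q₁) Q₁.primeCompl_le_nonZeroDivisors) p
  -- transport `𝒪_y ≅ (k[Y]/(g₁,g₂))_y ≅ (S₁/(ḡ₂))_{Q'} ≅ R₁ ⧸ (ḡ₂)` and conclude by the abstract core
  intro hfull
  have hloc : FullCl p (Localization.AtPrime y.asIdeal) :=
    WFixAtNonClosedDimTwo.fullCl_of_ringEquiv p (Spec.stalkIso (.of _) y).commRingCatIsoToRingEquiv hfull
  have hloc' := LocalBlowupBadFibreFromCharts.fullCl_localization_of_ringEquiv p (A := MvPolynomial (Fin m) k ⧸ Ideal.span {g₁, g₂})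
    (B := (MvPolynomial (Fin m) k ⧸ Ideal.span (Set.range f₁)) ⧸ Ideal.span {Ideal.Quotient.mk (Ideal.span (Set.range f₁)) g₂}) e₀ y.asIdeal Q' hyQ' hloc
  obtain ⟨eI⟩ := exists_quotLocalizationEquiv (Ideal.span {Ideal.Quotient.mk (Ideal.span (Set.range f₁)) g₂}) Q'
  have h3 : (Ideal.span {Ideal.Quotient.mk (Ideal.span (Set.range f₁)) g₂}).map (algebraMap _ (Localization.AtPrime Q₁)) =
      Ideal.span {algebraMap _ (Localization.AtPrime Q₁) (Ideal.Quotient.mk (Ideal.span (Set.range f₁)) g₂)} := by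
    rw [Ideal.map_span, Set.image_singleton]
  exact not_fullCl_of_mem_sup_atPrime p Q₁ (Ideal.Quotient.mk (Ideal.span (Set.range f₁))) a haQ g₁ g₂ hg₁0 hg₂Q hg₂0 hmem
    (eI.symm.trans (Ideal.quotEquivOfEq h3)) hloc'

/-! ## §3 ★ The pencil chart over a regular hypersurface base -/

/-- ★ **THE PENCIL CHART `V(G, M·L − B)` IS NOT FULL OVER A DEEP POINT** (`G` prime — the regular base —, `G ∤ M·L − B`; any point `y` with `𝔭_y ∩ k[Y] = (aᵢ)`, `∂_i G ∉ 𝔭_y`; the DEEP condition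
`M^j·B^{p−1−j} ∈ (aᵢ^p) + (G)` for all `0 ≤ j ≤ p − 1`; `L` arbitrary): `𝒪_{V(G, M·L − B), y}` is NOT `FullCl p`. [OURS · certificate shape; cite: Fedder1983, Thm. 1.12] -/
theorem pencilChartCI_not_full_of_deep (p : ℕ) [Fact p.Prime] [CharP k p] {m m' : ℕ} (G M B L : MvPolynomial (Fin m) k) (hG : Prime G) (hGL : ¬ G ∣ M * L - B)
    (a : Fin m' → MvPolynomial (Fin m) k) (y : Spec (.of (MvPolynomial (Fin m) k ⧸ Ideal.span {G, M * L - B})))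
    (ha : y.asIdeal.comap (Ideal.Quotient.mk (Ideal.span {G, M * L - B})) = Ideal.span (Set.range a))
    (i : Fin m) (hjac : pderiv i G ∉ y.asIdeal.comap (Ideal.Quotient.mk (Ideal.span {G, M * L - B})))
    (hdeep : ∀ j ≤ p - 1, M ^ j * B ^ (p - 1 - j) ∈ Ideal.span (Set.range fun j : Fin m' => a j ^ p) ⊔ Ideal.span {G}) :
    ¬ FullCl p ((Spec (.of (MvPolynomial (Fin m) k ⧸ Ideal.span {G, M * L - B}))).presheaf.stalk y) :=
  ci2_not_fullCl_stalk_of_mem k p G (M * L - B) hG hGL a y ha i hjac (PencilFedder.pencil_pow_mem _ p M B hdeep L)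

end Summit.ResolutionOfSingularities.ResolutionOfSingularities.Theorems.FInjectiveMacaulayfication.PencilFedderNotFullCI

end
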